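import Mathlib
import HarnessLib
import Summits.HubbardSuperconductivity.HubbardSuperconductivity.Theorems.ChiralWindowCwKLChiralWindowChannelFar
import Summits.HubbardSuperconductivity.HubbardSuperconductivity.Theorems.ChiralWindowCwKLChiralWindowCertTrig

/-!
# Crux `CwKLChiralWindow` (stmt-1741), line `Sketch`: block-level Ritz/Temple/far-channel bounds

`stub_klBlockBounds`: for a channel block `b : KLBlock` of the certificate record with its enclosures
`b.Enclosure tab μ χ` at a level `μ ∈ (-4,0)` (`Theorems/ChiralWindowDefs.lean`), the checker's rational bounds are
sound: if `b.lowerOK tab χ` then `b.lower tab χ ≤ channelInf ε₀ μ 1 χ`, and if `b.templeOK tab χ` in the equality case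
`withU ∨ χ ≠ A1g` then `channelInf ε₀ μ 1 χ ≤ b.upper`.  The proof only UNPACKS the record: the Booleans
`templeOK` / `farOK` give the rational side conditions, the enclosures give the real inequalities
(`kl_bkb_arith`), the deflation list becomes a `Fin`-indexed family (`kl_bkb_deflKernel_eq`), and the landed abstract
bounds `stub_klChannelBound` (Ritz/Temple, `kl_bkb_temple`) and `stub_klChannelFar` (far channel, `kl_bkb_far`) are
instantiated with `Φ = b.trialFun tab`, `ρlo = b.rholo`, `ρhi = b.rhohi`, `α = b.alpha`, `h = b.Hhi`, `β = b.beta`,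
`s = b.s`.
-/

noncomputable section

set_option linter.dupNamespace false

namespace Summit.HubbardSuperconductivity.HubbardSuperconductivity.Theorems

open MeasureTheory Literature.MathematicalPhysics.QuantumLattice CwKLChiralWindow

/-! ### Dictionary: the record's lists, Booleans and rationals -/

/-- The deflation kernel of a block as a `Fin`-indexed sum over its deflation list. [folklore] -/
theorem kl_bkb_deflKernel_eq (b : KLBlock) (tab : List KLTrig) (k k' : Momentum) :
    b.deflKernel tab k k' = ∑ m : Fin b.defl.length,
      ((b.defl[(m : ℕ)].1 : ℚ) : ℝ) * ((klTab tab b.defl[(m : ℕ)].2).toFun k * (klTab tab b.defl[(m : ℕ)].2).toFun k') := by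
  unfold KLBlock.deflKernel
  rw [← List.ofFn_getElem_eq_map, List.sum_ofFn]

/-- The deflated sector square mass of a block, written in the form of the abstract channel theorems. [folklore] -/
theorem kl_bkb_sqmass_eq (b : KLBlock) (tab : List KLTrig) (μ : ℝ) (χ : D4Irrep) :
    ∫ z, (d4Project χ (fun q => (if b.withU then 1 else 0) + lindhardFunction (squareDispersion 1 0) μ (z.1 + q)) z.2 -
        ∑ m : Fin b.defl.length, ((b.defl[(m : ℕ)].1 : ℚ) : ℝ) *
          ((klTab tab b.defl[(m : ℕ)].2).toFun z.1 * (klTab tab b.defl[(m : ℕ)].2).toFun z.2)) ^ 2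
        ∂(fermiCurveMeasure (squareDispersion 1 0) μ).prod (fermiCurveMeasure (squareDispersion 1 0) μ) =
    ∫ z, (b.sectorKernel μ χ z.1 z.2 - b.deflKernel tab z.1 z.2) ^ 2
        ∂(fermiCurveMeasure (squareDispersion 1 0) μ).prod (fermiCurveMeasure (squareDispersion 1 0) μ) := by
  simp only [KLBlock.sectorKernel, KLBlock.baseKernel, kl_bkb_deflKernel_eq]

/-- Admissible deflation: the weights are non-negative. [folklore] -/
theorem kl_bkb_defl_nonneg {b : KLBlock} {tab : List KLTrig} {χ : D4Irrep} (h : b.deflOK tab χ = true)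
    (m : Fin b.defl.length) : (0 : ℝ) ≤ ((b.defl[(m : ℕ)].1 : ℚ) : ℝ) := by
  simp only [KLBlock.deflOK, List.all_eq_true, Bool.and_eq_true, decide_eq_true_eq] at h
  exact_mod_cast (h _ (List.getElem_mem m.2)).1.1

/-- The `withU` test of the checker: `(!withU || χ = A1g)` means `withU → χ = A1g`. [folklore] -/
theorem kl_bkb_withU {w : Bool} {χ : D4Irrep} (h : (!w || decide (χ = D4Irrep.A1g)) = true) :
    w = true → χ = D4Irrep.A1g := by
  intro hw
  subst hw
  simpa using h

/-- Real arithmetic of the Rayleigh-quotient enclosure: from `0 < Nlo ≤ N ≤ Nhi`, `Qlo ≤ Q ≤ Qhi < 0`, `T ≤ Thi`,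
`0 ≤ Thi` one gets `0 < N`, `ρlo N ≤ Q ≤ ρhi N`, `ρhi < 0`, `T ≤ α N` with `ρlo = min (Qlo/Nlo) (Qlo/Nhi)`,
`ρhi = max (Qhi/Nlo) (Qhi/Nhi)`, `α = Thi/Nlo`. [folklore] -/
theorem kl_bkb_arith {Nlo Nhi Qlo Qhi Thi N Q T : ℝ} (hNlo : 0 < Nlo) (hQhi : Qhi < 0) (hThi : 0 ≤ Thi)
    (h1 : Nlo ≤ N) (h2 : N ≤ Nhi) (h3 : Qlo ≤ Q) (h4 : Q ≤ Qhi) (h5 : T ≤ Thi) :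
    0 < N ∧ min (Qlo / Nlo) (Qlo / Nhi) * N ≤ Q ∧ Q ≤ max (Qhi / Nlo) (Qhi / Nhi) * N ∧
      max (Qhi / Nlo) (Qhi / Nhi) < 0 ∧ T ≤ Thi / Nlo * N := by
  have hN : 0 < N := hNlo.trans_le h1
  have hNhi : 0 < Nhi := hN.trans_le h2
  refine ⟨hN, ?_, ?_, max_lt (div_neg_of_neg_of_pos hQhi hNlo) (div_neg_of_neg_of_pos hQhi hNhi), ?_⟩
  · rcases le_or_gt 0 Qlo with hQ | hQ
    · calc min (Qlo / Nlo) (Qlo / Nhi) * N ≤ Qlo / Nhi * N := mul_le_mul_of_nonneg_right (min_le_right _ _) hN.le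
        _ ≤ Qlo / Nhi * Nhi := mul_le_mul_of_nonneg_left h2 (div_nonneg hQ hNhi.le)
        _ = Qlo := div_mul_cancel₀ _ hNhi.ne'
        _ ≤ Q := h3
    · calc min (Qlo / Nlo) (Qlo / Nhi) * N ≤ Qlo / Nlo * N := mul_le_mul_of_nonneg_right (min_le_left _ _) hN.le
        _ ≤ Qlo / Nlo * Nlo := mul_le_mul_of_nonpos_left h1 (div_nonpos_of_nonpos_of_nonneg hQ.le hNlo.le)
        _ = Qlo := div_mul_cancel₀ _ hNlo.ne'
        _ ≤ Q := h3
  · calc Q ≤ Qhi := h4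
      _ = Qhi / Nhi * Nhi := (div_mul_cancel₀ _ hNhi.ne').symm
      _ ≤ Qhi / Nhi * N := mul_le_mul_of_nonpos_left h2 (div_neg_of_neg_of_pos hQhi hNhi).le
      _ ≤ max (Qhi / Nlo) (Qhi / Nhi) * N := mul_le_mul_of_nonneg_right (le_max_right _ _) hN.le
  · calc T ≤ Thi := h5
      _ = Thi / Nlo * Nlo := (div_mul_cancel₀ _ hNlo.ne').symm
      _ ≤ Thi / Nlo * N := mul_le_mul_of_nonneg_left h1 (div_nonneg hThi hNlo.le)

/-! ### The two abstract bounds, instantiated with the block data -/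

/-- **Temple/Ritz bounds of a block.** If the checker accepts the Temple data of the block (`templeOK`) and the block
enclosures hold at `μ`, then `min (f ρlo) (f ρhi) ≤ channelInf ε₀ μ 1 χ` with `f ρ = (β ρ - α)/(β - ρ)` (all data the
block's rationals `rholo, rhohi, alpha, beta`), and in the equality case `withU ∨ χ ≠ A1g` also
`channelInf ε₀ μ 1 χ ≤ ρhi`: `stub_klChannelBound` with the block's trial `b.trialFun tab` and deflation list. [folklore] -/
theorem kl_bkb_temple {μ : ℝ} (hμ : μ ∈ Set.Ioo (-4 : ℝ) 0) (b : KLBlock) (tab : List KLTrig) (χ : D4Irrep)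
    (hT : b.templeOK tab χ = true) (hE : b.Enclosure tab μ χ) :
    min (((b.beta : ℝ) * (b.rholo : ℝ) - (b.alpha : ℝ)) / ((b.beta : ℝ) - (b.rholo : ℝ)))
        (((b.beta : ℝ) * (b.rhohi : ℝ) - (b.alpha : ℝ)) / ((b.beta : ℝ) - (b.rhohi : ℝ))) ≤
      channelInf (squareDispersion 1 0) μ 1 χ ∧
    ((b.withU = true ∨ χ ≠ D4Irrep.A1g) → channelInf (squareDispersion 1 0) μ 1 χ ≤ (b.rhohi : ℝ)) := by
  have hT' := hT
  simp only [KLBlock.templeOK, KLBlock.ritzOK, Bool.and_eq_true, decide_eq_true_eq] at hT'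
  obtain ⟨⟨⟨⟨⟨⟨⟨⟨⟨⟨⟨⟨hut, -⟩, hfits⟩, hNlo⟩, -⟩, -⟩, hQhi⟩, hwu⟩, hdefl⟩, hThi⟩, hβ0⟩, hHβ⟩, hρβ⟩ := hT'
  obtain ⟨hE1, hE2⟩ := hE
  obtain ⟨h1, h2, h3, h4, h5⟩ := hE1 hut
  simp only [KLBlock.baseKernel] at h3 h4 h5
  obtain ⟨hN, hρlo, hρhi, hρhi0, hα⟩ :=
    kl_bkb_arith (by exact_mod_cast hNlo) (by exact_mod_cast hQhi) (by exact_mod_cast hThi) h1 h2 h3 h4 h5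
  have hrholo : ((b.rholo : ℚ) : ℝ) = min ((b.Qlo : ℝ) / (b.Nlo : ℝ)) ((b.Qlo : ℝ) / (b.Nhi : ℝ)) := by
    push_cast [KLBlock.rholo]; rfl
  have hrhohi : ((b.rhohi : ℚ) : ℝ) = max ((b.Qhi : ℝ) / (b.Nlo : ℝ)) ((b.Qhi : ℝ) / (b.Nhi : ℝ)) := by
    push_cast [KLBlock.rhohi]; rfl
  have halpha : ((b.alpha : ℚ) : ℝ) = (b.Thi : ℝ) / (b.Nlo : ℝ) := by
    push_cast [KLBlock.alpha]; rfl
  rw [← hrholo] at hρlo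
  rw [← hrhohi] at hρhi hρhi0
  rw [← halpha] at hα
  have hβ : (b.Hhi : ℝ) - (if χ = D4Irrep.E then 2 else 1) * (b.rhohi : ℝ) ^ 2 ≤ (b.beta : ℝ) ^ 2 := by
    have h := (Rat.cast_le (K := ℝ)).2 hHβ
    unfold KLBlock.dmult at h
    split_ifs at h ⊢ <;> push_cast at h <;> linarith
  exact stub_klChannelBound μ hμ χ b.withU b.defl.length (fun m => ((b.defl[(m : ℕ)].1 : ℚ) : ℝ))
    (fun m => (klTab tab b.defl[(m : ℕ)].2).toFun) (b.trialFun tab) (b.rholo : ℝ) (b.rhohi : ℝ) (b.alpha : ℝ)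
    (b.Hhi : ℝ) (b.beta : ℝ) (kl_bkb_withU hwu) (kl_bkb_defl_nonneg hdefl) (fun m => kl_tr_toFun_memLp _ hμ)
    (kl_tr_toFun_memLp (klTab tab b.trial) hμ) (stub_klTrigChannel (klTab tab b.trial) χ hfits) hN hρlo hρhi hρhi0
    hα ((kl_bkb_sqmass_eq b tab μ χ).trans_le hE2) (by exact_mod_cast hβ0) hβ (by exact_mod_cast hρβ)

/-- **Far-channel bound of a block.** If the checker accepts the far-channel data of the block (`farOK`) and the block
enclosures hold at `μ`, then `-s ≤ channelInf ε₀ μ 1 χ`: `stub_klChannelFar` with the block's deflation list and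
`h = Hhi`. [folklore] -/
theorem kl_bkb_far {μ : ℝ} (hμ : μ ∈ Set.Ioo (-4 : ℝ) 0) (b : KLBlock) (tab : List KLTrig) (χ : D4Irrep)
    (hF : b.farOK tab χ = true) (hE : b.Enclosure tab μ χ) :
    -(b.s : ℝ) ≤ channelInf (squareDispersion 1 0) μ 1 χ := by
  have hF' := hF
  simp only [KLBlock.farOK, Bool.and_eq_true, decide_eq_true_eq] at hF'
  obtain ⟨⟨⟨hdefl, hs⟩, hHs⟩, hwu⟩ := hF'
  exact stub_klChannelFar μ hμ χ b.withU b.defl.length (fun m => ((b.defl[(m : ℕ)].1 : ℚ) : ℝ))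
    (fun m => (klTab tab b.defl[(m : ℕ)].2).toFun) (b.Hhi : ℝ) (b.s : ℝ) (kl_bkb_withU hwu)
    (kl_bkb_defl_nonneg hdefl) (fun m => kl_tr_toFun_memLp _ hμ) ((kl_bkb_sqmass_eq b tab μ χ).trans_le hE.2)
    (by exact_mod_cast hs) (by exact_mod_cast hHs)

/-! ### The stub -/

/-- **Block-level soundness of the checker's bounds** (`stub_klBlockBounds`): for a block `b` with its enclosures at the
level `μ ∈ (-4,0)` in the channel `χ`: if the checker certifies a lower bound (`lowerOK`: Temple data or far-channel data)
then `b.lower tab χ ≤ channelInf ε₀ μ 1 χ` (`…ChannelBound` with the trial `Φ = b.trialFun tab`, `ρlo = b.rholo`,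
`ρhi = b.rhohi`, `α = b.alpha`, `h = b.Hhi`, `β = b.beta` and the deflation of the block, or `…ChannelFar` with `s = b.s`);
if it accepts Temple data and the block is in the equality case (`withU ∨ χ ≠ A1g`) then `channelInf ε₀ μ 1 χ ≤ b.upper`
(Ritz). [folklore] -/
theorem stub_klBlockBounds : ∀ μ ∈ Set.Ioo (-4 : ℝ) 0, ∀ (b : KLBlock) (tab : List KLTrig) (χ : D4Irrep),
    b.Enclosure tab μ χ →
    (b.lowerOK tab χ = true → ((b.lower tab χ : ℚ) : ℝ) ≤ channelInf (squareDispersion 1 0) μ 1 χ) ∧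
    (b.templeOK tab χ = true → (b.withU = true ∨ χ ≠ D4Irrep.A1g) →
      channelInf (squareDispersion 1 0) μ 1 χ ≤ ((b.upper : ℚ) : ℝ)) := by
  intro μ hμ b tab χ hE
  refine ⟨fun hL => ?_, fun hT hcase => (kl_bkb_temple hμ b tab χ hT hE).2 hcase⟩
  cases hT : b.templeOK tab χ with
  | true =>
    have h := (kl_bkb_temple hμ b tab χ hT hE).1
    rw [KLBlock.lower, if_pos hT]
    push_cast [KLBlock.temple]
    exact h
  | false =>
    have hF : b.farOK tab χ = true := by simpa [KLBlock.lowerOK, hT] using hL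
    simp only [KLBlock.lower, hT, Bool.false_eq_true, ↓reduceIte]
    push_cast
    exact kl_bkb_far hμ b tab χ hF hE

end Summit.HubbardSuperconductivity.HubbardSuperconductivity.Theorems

end
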